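import Summits.QuantumAdvantage.AdviceFreeQNC0.WalkExactLaw
import HarnessLib

/-!
# Cell qa-qnc0, planner p2 gen 37 — TYPED TARGETS for ROUND-37P2 (dual-basis decimation)

Statements only (custody D-0168: nothing here is proposed to the tree).  `LfunChiDirLaw` = Lemma 37.D0,
`FibreNonExact37` = Theorem 37.F (constant-target form) of `qa-qnc0-p2/ROUND-37P2.md` §2; v2: `NHCond` +
`FibreNonExact37NH` = Theorem 37.F′ (affine targets, hypothesis (NH)), `MixedExcludes` = §3.5 exclusion step; v3: `NHSCond` +
`FibreNonExact37NHS` = §3.8 (ii) (mixed populations: generic tests + any function of `R` label forms).  Over the tree's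
`F4`, `ω`, `lett`, `chi`, `Lfun` (`WalkCharacters.lean`, `WalkExactLaw.lean`).
-/

noncomputable section

namespace Summit.QuantumAdvantage.AdviceFreeQNC0.Exp37

open Finset
open Summit.QuantumAdvantage.AdviceFreeQNC0 F4

variable {m : ℕ}

/-- Character of a GENERAL direction `δ ∈ 𝔽₃^m` (zeros allowed): `χ_δ(u) = ω^{⟨δ,u⟩}`. -/
def chiDir (δ : Fin m → ZMod 3) (u : Fin m → Bool) : F4 :=
  ∏ i, (if u i then ω ^ (δ i).val else 1)

/-- The letter of a Boolean pattern entry as an element of `𝔽₃` (`false ↦ 1`, `true ↦ 2`). -/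
def lettZ (b : Bool) : ZMod 3 := (lett b : ZMod 3)

/-- `δ` is `a`-compatible: on its support it carries the letters of `a`. -/
def Compatible (a : Fin m → Bool) (δ : Fin m → ZMod 3) : Prop :=
  ∀ i, δ i ≠ 0 → δ i = lettZ (a i)

open Classical in
/-- Lemma 37.D0: the dual functional `L_a` on a general character — a unit if compatible, zero otherwise:
`L_a(χ_δ) = [δ a-compatible] · ∏_{i : δ i = 0} ω^{lett (a i)}`. -/
def LfunChiDirLaw : Prop :=
  ∀ (m : ℕ) (a : Fin m → Bool) (δ : Fin m → ZMod 3),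
    Lfun a (chiDir δ) =
      if Compatible a δ then ∏ i ∈ univ.filter (fun i => δ i = 0), ω ^ lett (a i) else 0

/-! ### Theorem 37.F (constant target) -/

variable {z s : ℕ}

/-- The MOD-3 test of player `k` at coin vector `u`: `[⟨β_k,u⟩ ≢ r_k]`. -/
def test (β : Fin s → Fin z → ZMod 3) (r : Fin s → ZMod 3) (k : Fin s) (u : Fin z → Bool) : Bool :=
  decide ((∑ i, if u i then β k i else 0) ≠ r k)

/-- The parity `f(u) = Σ_k [⟨β_k,u⟩ ≢ r_k] mod 2`. -/
def testParity (β : Fin s → Fin z → ZMod 3) (r : Fin s → ZMod 3) (u : Fin z → Bool) : ℕ :=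
  (univ.filter fun k => test β r k u = true).card % 2

/-- Parity coset `H_ε = {u : |u| ≡ ε (mod 2)}` of the coin cube. -/
def coset (z : ℕ) (ε : ℕ) : Finset (Fin z → Bool) :=
  univ.filter fun u => (univ.filter fun i => u i = true).card % 2 = ε % 2

/-- Restriction of direction `β_k` to the `m` chosen coins `ι`. -/
def restrictM (ι : Fin m ↪ Fin z) (β : Fin s → Fin z → ZMod 3) (k : Fin s) : Fin m → ZMod 3 :=
  fun i => β k (ι i)

/-- The J-condition of ROUND-37P2 §2: `δ ≠ 0` and one of `±δ`, `±δ + e_i` is `a`-compatible. -/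
def JCond (a : Fin m → Bool) (δ : Fin m → ZMod 3) : Prop :=
  δ ≠ 0 ∧ (Compatible a δ ∨ Compatible a (-δ) ∨
    ∃ i, Compatible a (δ + Pi.single i 1) ∨ Compatible a (-δ + Pi.single i 1))

/-- The decimated set `J = {k : JCond a (β_k|_M)}`. -/
def decimSet (ι : Fin m ↪ Fin z) (a : Fin m → Bool) (β : Fin s → Fin z → ZMod 3) : Finset (Fin s) := by
  classical exact univ.filter fun k => JCond a (restrictM ι β k)

/-- `Y`-weight of the combination `Σ_k j_k β_k` (coins outside the range of `ι`). -/
def weightY (ι : Fin m ↪ Fin z) (β : Fin s → Fin z → ZMod 3) (j : Fin s → ZMod 3) : ℕ :=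
  (univ.filter fun c : Fin z => c ∉ Set.range ι ∧ (∑ k, j k * β k c) ≠ 0).card

/-- (Gen_d): every non-zero combination supported on `J` has `Y`-weight `≥ d`, and `d` is large enough for the L¹ step:
`(5/3)^{|J|}·(2^{−d} + (√3/2)^{z−m}) ≤ 1/20`. -/
def GenD (ι : Fin m ↪ Fin z) (a : Fin m → Bool) (β : Fin s → Fin z → ZMod 3) (d : ℕ) : Prop :=
  (∀ j : Fin s → ZMod 3, j ≠ 0 → (∀ k, k ∉ decimSet ι a β → j k = 0) → d ≤ weightY ι β j) ∧
  ((5 : ℝ) / 3) ^ (decimSet ι a β).card * ((2 : ℝ)⁻¹ ^ d + (Real.sqrt 3 / 2) ^ (z - m)) ≤ 1 / 20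

/-- **Theorem 37.F (constant target), typed.**  If test `k₀`'s direction carries the nowhere-zero pattern `a` on the
`m` coins `ι` (`m` odd) and the decimated system is (Gen_d), then on either parity coset the parity of the tests agrees
with any constant on at most a `1 − 2^{−m−2}` fraction: `#{u ∈ H_ε : f(u) = b} ≤ (1 − 2^{−(m+2)})·2^{z−1}`. -/
def FibreNonExact37 : Prop :=
  ∀ (z s m d : ℕ) (ι : Fin m ↪ Fin z) (β : Fin s → Fin z → ZMod 3) (r : Fin s → ZMod 3) (k₀ : Fin s)
    (a : Fin m → Bool),
    Odd m → 1 ≤ z - m →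
    (∀ i, β k₀ (ι i) = lettZ (a i)) →
    GenD ι a β d →
    ∀ (ε b : ℕ), (((coset z ε).filter fun u => testParity β r u = b % 2).card : ℝ)
        ≤ (1 - (2 : ℝ)⁻¹ ^ (m + 2)) * (2 : ℝ) ^ (z - 1)


/-! ## v2 additions (ROUND-37P2 §2 Theorem 37.F′ and §3.5) -/

/-- Hypothesis (NH) of Theorem 37.F′: the decimated set is small (`6|J| ≤ |Y|`) and the decimated code on `Y` is
not `3/4`-heavy: `Σ_{0 ≠ j supported on J} (3/4)^{w(j)} ≤ 1/50`.  No general-position assumption. -/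
def NHCond {z s : ℕ} (ι : Fin m ↪ Fin z) (a : Fin m → Bool) (β : Fin s → Fin z → ZMod 3) : Prop := by
  classical exact
  6 * (decimSet ι a β).card ≤ z - m ∧
  (∑ j ∈ (univ : Finset (Fin s → ZMod 3)).filter
      (fun j => j ≠ 0 ∧ ∀ k, k ∉ decimSet ι a β → j k = 0),
      ((3 : ℝ) / 4) ^ weightY ι β j) ≤ 1 / 50

/-- An 𝔽₂-affine target on the coin cube: `u ↦ μ₀ + #{c ∈ S : u_c}` (mod 2). -/
def affTarget {z : ℕ} (μ₀ : ℕ) (S : Finset (Fin z)) (u : Fin z → Bool) : ℕ :=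
  μ₀ + (S.filter fun c => u c = true).card

/-- **Theorem 37.F′ (target).**  Under (NH), for an odd `m`, a test `k₀` whose letters on `M = range ι` are `a`,
every 𝔽₂-affine target is missed on at least a `2^{-(m+3)}` fraction of the parity coset:
`#{u ∈ H_ε : f(u) ≡ λ(u)} ≤ (1 − 2^{−m−3})·2^{z−1}`. -/
def FibreNonExact37NH : Prop :=
  ∀ (z s m : ℕ) (ι : Fin m ↪ Fin z) (β : Fin s → Fin z → ZMod 3) (r : Fin s → ZMod 3) (k₀ : Fin s)
    (a : Fin m → Bool),
    Odd m → 1 ≤ z - m →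
    (∀ i, β k₀ (ι i) = lettZ (a i)) →
    NHCond ι a β →
    ∀ (ε μ₀ : ℕ) (S : Finset (Fin z)),
      (((coset z ε).filter fun u => testParity β r u % 2 = affTarget μ₀ S u % 2).card : ℝ)
        ≤ (1 - (2 : ℝ)⁻¹ ^ (m + 3)) * (2 : ℝ) ^ (z - 1)

/-- **§3.5 mixed decimation, the exclusion step (target; pure letter bookkeeping).**  A row whose letters on `M`
are `−a` on a part `M₁` with `|M₁| ≥ 3` and `a` on the complement with `|M ∖ M₁| ≥ 3` (this is what every
seed-mate of `k₀` reads when `M₁ ⊆ {d_{k₀} = c ≠ 0}` and `M₂ ∩ supp d_{k₀} = ∅`) fails the J-condition. -/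
def MixedExcludes : Prop :=
  ∀ (m : ℕ) (a : Fin m → Bool) (M₁ : Finset (Fin m)),
    3 ≤ M₁.card → 3 ≤ (univ \ M₁).card →
    ¬ JCond a (fun i => if i ∈ M₁ then -lettZ (a i) else lettZ (a i))

/- sanity instance of `MixedExcludes` at `m = 7`, `M₁ = {0,1,2}`, all letters of `a` equal to `1`
(w.l.o.g. by the letter symmetry; kernel-checked by `decide`). -/
set_option maxRecDepth 8000 in
example : ¬ JCond (fun _ : Fin 7 => false)
    (fun i => if i ∈ ({0, 1, 2} : Finset (Fin 7)) then -lettZ false else lettZ false) := by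
  unfold JCond Compatible lettZ
  simp only [lett]
  decide

/-! ## v3 additions (ROUND-37P2 §3.8 (ii): mixed populations — generic tests plus ANY function of `R` label forms) -/

/-- `Y`-weight of a general direction `δ ∈ 𝔽₃^z` (coins outside the range of `ι`). -/
def weightYDir {z : ℕ} (ι : Fin m ↪ Fin z) (δ : Fin z → ZMod 3) : ℕ :=
  (univ.filter fun c : Fin z => c ∉ Set.range ι ∧ δ c ≠ 0).card

/-- Hypothesis (NH/S) of §3.8 (ii): the decimated generic code TOGETHER WITH the span of the `R` label forms `S` is not
`3/4`-heavy on `Y`: `Σ_{(j,γ) ≠ (0,0), supp j ⊆ J} (3/4)^{wt_Y(Σ_k j_k β_k + Σ_i γ_i S_i)} ≤ 1/50`, and `6(|J|+R) ≤ |Y|`. -/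
def NHSCond {z s R : ℕ} (ι : Fin m ↪ Fin z) (a : Fin m → Bool) (β : Fin s → Fin z → ZMod 3)
    (S : Fin R → Fin z → ZMod 3) : Prop := by
  classical exact
  6 * ((decimSet ι a β).card + R) ≤ z - m ∧
  (∑ jγ ∈ (univ : Finset ((Fin s → ZMod 3) × (Fin R → ZMod 3))).filter
      (fun jγ => jγ ≠ 0 ∧ ∀ k, k ∉ decimSet ι a β → jγ.1 k = 0),
      ((3 : ℝ) / 4) ^ weightYDir ι (fun c => (∑ k, jγ.1 k * β k c) + ∑ i, jγ.2 i * S i c)) ≤ 1 / 50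

/-- The vector of label values `(⟨S_i, u⟩)_i ∈ 𝔽₃^R` at coin vector `u`. -/
def labelVal {z R : ℕ} (S : Fin R → Fin z → ZMod 3) (u : Fin z → Bool) : Fin R → ZMod 3 :=
  fun i => ∑ c, if u c then S i c else 0

/-- **§3.8 (ii) (target): fibre non-exactness for a MIXED population.**  Generic tests `β` (decimated around `k₀` as in
37.F′) plus an ARBITRARY Boolean function `h` of `R` label forms `S` (the seeded sub-family's whole contribution, tables,
signs and all): under (NH/S) every 𝔽₂-affine target is missed on a `2^{-(m+3)}` fraction of the parity coset.  The seeded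
factor is controlled by Parseval on the label group `𝔽₃^R`; no expansion of a WIN indicator occurs (B-37P2.2 evaded). -/
def FibreNonExact37NHS : Prop :=
  ∀ (z s m R : ℕ) (ι : Fin m ↪ Fin z) (β : Fin s → Fin z → ZMod 3) (r : Fin s → ZMod 3) (k₀ : Fin s)
    (a : Fin m → Bool) (S : Fin R → Fin z → ZMod 3) (h : (Fin R → ZMod 3) → Bool),
    Odd m → 1 ≤ z - m →
    (∀ i, β k₀ (ι i) = lettZ (a i)) →
    NHSCond ι a β S →
    ∀ (ε μ₀ : ℕ) (T : Finset (Fin z)),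
      (((coset z ε).filter fun u =>
          (testParity β r u + (if h (labelVal S u) then 1 else 0)) % 2 = affTarget μ₀ T u % 2).card : ℝ)
        ≤ (1 - (2 : ℝ)⁻¹ ^ (m + 3)) * (2 : ℝ) ^ (z - 1)

end Summit.QuantumAdvantage.AdviceFreeQNC0.Exp37
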